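import Summits.BirchSwinnertonDyer.BirchSwinnertonDyer.Theorems.ManinLocalTwoThreeKLineSigmaClosed
import Summits.BirchSwinnertonDyer.BirchSwinnertonDyer.Theorems.ManinLocalTwoThreeShimuraThreeTorsionOfCuspLifting
import Summits.BirchSwinnertonDyer.BirchSwinnertonDyer.Theorems.ManinLocalTwoThreeCuspZeroAnnihilatorOfCuspGalois
import Literature.NumberTheory.EllipticCurves.Gamma1ParametrizationCuspZeroGaloisOrbit
import HarnessLib

/-!
# C3 `ManinPrimeToThreeAtNine` ⟸ SIX PRINTED FACTS — the by-name composition of skeleton v34 (no cell conjecture left)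
(route `ManinLocalTwoThree`, crux C3 stmt-BirchSwinnertonDyer-22968; cell bsd-f2-manin, width prover p3 g17; `--supports stmt-BirchSwinnertonDyer-22968`)

The registered skeleton v33 (C3 LEAD p1 g17, tree image `…KLineSigmaClosed`, p742267) reads C3 ⟸ F₃♮ ∧ CDT-algInt ∧ E-an-221.
an g40 FILE 1 (`…ShimuraThreeTorsionOfCuspLifting`, p743609) gives E-an-221 ⟸ E-an-128; an g41 FILE Θ (`…CuspZeroAnnihilatorOfCuspGalois`,
p743718) gives E-an-128 ⟸ F★₀ ∧ F★ ∧ F♮ ∧ CES with F♮ as a section binder; typer g21's `Gamma1ParametrizationCuspZeroGaloisOrbit` (p742727)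
names F♮ `optimalGamma1Parametrization_cuspZero_galoisConjugate` (Stevens 1982 Thm 1.3.1 (b), same text).  This file is the composition
BY NAME (an g41's certified scratch `ComposeE221OfPrint-scratch-an-g41.lean` 4a63151cc7eeb3a3, MEMO-an §86):

* `shimuraThreeForcesRationalThreeTorsion_of_print` — E-an-128 ⟸ F★₀ ∧ F★ ∧ F♮ ∧ CES (all four NAMED Literature facts);
* `shimuraThreeKernelForcesRationalThreeTorsionAtNine_of_print` — **E-an-221 ⟸ F★₀ ∧ F★ ∧ F♮ ∧ CES**;
* **`maninPrimeToThreeAtNine_of_sixPrintedFacts : F₃♮ → CDT-algInt → F★₀ → F★ → F♮ → CES → ManinPrimeToThreeAtNine`**.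

The six hypotheses are statement-only Literature facts (PRINTED, cite-only): Kato 2004 Thm 9.7 in the Kosters–Pannekoek form (F₃♮),
Calegari–Dimitrov–Tang 2025 Thm 1.0.1 (CDT-algInt), Cremona 1997 §2.6 / Edixhoven (F★₀), Conrad–Edixhoven–Stein 2003 §6.1.2 (F★, CES),
Stevens 1982 Thm 1.3.1 (F♮).  CONDITIONAL result: C3 is NOT proved unconditionally; Manin's conjecture is NOT proved; BSD is NOT proved by this.
-/

set_option autoImplicit false
set_option linter.dupNamespace false

noncomputable section

open WeierstrassCurve Literature.NumberTheory.EllipticCurves Literature.NumberTheory.EllipticCurves.ModularForms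
open Summit.BirchSwinnertonDyer.Rank1Residual.ManinAdditive.ShimuraThreeTorsion
open Summit.BirchSwinnertonDyer.Rank1Residual.ManinAdditive.KatoCurve

namespace Summit.BirchSwinnertonDyer.BirchSwinnertonDyer.Theorems.ManinLocalTwoThree.SixPrintedFacts

/-- **E-an-128 ⟸ F★₀ ∧ F★ ∧ F♮ ∧ CES, all four by their Literature names** (an g41 FILE Θ with the binder `hB` discharged by
`optimalGamma1Parametrization_cuspZero_galoisConjugate`).  CONDITIONAL on four printed facts.
[cite: Stevens1982, Thm. 1.3.1] [cite: ConradEdixhovenStein2003, §6.1.2] -/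
theorem shimuraThreeForcesRationalThreeTorsion_of_print
    (hF₀ : optimalParametrization_cuspZero_rational) (hF : optimalGamma1Parametrization_cusp_rational)
    (hFnat : optimalGamma1Parametrization_cuspZero_galoisConjugate) (hCES : exists_optimal_gamma1ParametrizationData) :
    ShimuraThreeForcesRationalThreeTorsion :=
  CuspGalois.shimuraThreeForcesRationalThreeTorsion_of_cuspGalois hFnat hF₀ hF hCES

/-- **E-an-221 ⟸ F★₀ ∧ F★ ∧ F♮ ∧ CES** (an g40 FILE 1 ∘ an g41 FILE Θ, by name): the last non-printed stub of C3 skeleton v33 is a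
consequence of four PRINTED facts.  CONDITIONAL on them. [cite: Stevens1982, Thm. 1.3.1] [cite: ConradEdixhovenStein2003, §6.1.2] -/
theorem shimuraThreeKernelForcesRationalThreeTorsionAtNine_of_print
    (hF₀ : optimalParametrization_cuspZero_rational) (hF : optimalGamma1Parametrization_cusp_rational)
    (hFnat : optimalGamma1Parametrization_cuspZero_galoisConjugate) (hCES : exists_optimal_gamma1ParametrizationData) :
    ShimuraThreeKernelForcesRationalThreeTorsionAtNine :=
  shimuraThreeKernelForcesRationalThreeTorsionAtNine_of_cuspLifting
    (shimuraThreeForcesRationalThreeTorsion_of_print hF₀ hF hFnat hCES)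

/-- **C3 `ManinPrimeToThreeAtNine` ⟸ SIX PRINTED FACTS: F₃♮ → CDT-algInt → F★₀ → F★ → F♮ → CES → C3** (skeleton v34 by name: LEAD's v33
image `KLineSigma.maninPrimeToThreeAtNine_of_katoFactKP_of_CDT_algInt_of_sigmaTorsion` fed with E-an-221-of-print).  CONDITIONAL
reduction to statement-only printed facts; C3 is NOT proved unconditionally; BSD is NOT proved by this.
[cite: Kato2004Asterisque, Thm. 9.7 (p. 189)] [cite: CalegariDimitrovTang2025, Thm. 1.0.1 and Remarks 58–59]
[cite: Stevens1982, Thm. 1.3.1] [cite: ConradEdixhovenStein2003, §6.1.2] -/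
theorem maninPrimeToThreeAtNine_of_sixPrintedFacts
    (hK : kato_neron_isIntegral_twistedSymbolSum_of_additive_three_kp)
    (hCDT : Literature.NumberTheory.Automorphic.CalegariDimitrovTang2025_unboundedDenominators_algInt)
    (hF₀ : optimalParametrization_cuspZero_rational) (hF : optimalGamma1Parametrization_cusp_rational)
    (hFnat : optimalGamma1Parametrization_cuspZero_galoisConjugate) (hCES : exists_optimal_gamma1ParametrizationData) :
    Summit.BirchSwinnertonDyer.BirchSwinnertonDyer.Theses.ManinLocalTwoThree.ManinPrimeToThreeAtNine :=
  KLineSigma.maninPrimeToThreeAtNine_of_katoFactKP_of_CDT_algInt_of_sigmaTorsion hK hCDT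
    (shimuraThreeKernelForcesRationalThreeTorsionAtNine_of_print hF₀ hF hFnat hCES)

end Summit.BirchSwinnertonDyer.BirchSwinnertonDyer.Theorems.ManinLocalTwoThree.SixPrintedFacts

end
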